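import Summits.Ventures.CertifiedManyBodySolver.Rows.CorrWindowCertKernelChain
import HarnessLib

/-!
# The ONE inequality, CHUNKED: `lowerConst (decPoly N C_M)` as a sum over consecutive slices of the final accumulator, one kernel fact per slice

HONEST FRAMING: Lean plumbing towards «tier P» (cell hubbard-obs). MEASURED (obs-p2 g24 probe Q1, farm, 2026-08-29): the closers' last hypothesis
`q ≤ lowerConst (SOSDual.decPoly N (Cs.getD M [])) + (Σμ)(n₀/2 − ν)` decided in ONE `decide +kernel` on a synthetic 7 272-entry accumulator with
≈ 130-bit numerators over ≈ 137-bit denominators took 578.9 s — at the 600-s file clock. Here the fold is split: `lowerConst` is ADDITIVE over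
concatenation (`constCoeff`/`l1Nonconst` are forced additive left folds: `foldl_add_eq` of `CertifiedQuantumChemistry/Rows/CARNormalOrder.lean`), `decPoly`
is a `map`, so `lowerConst (decPoly N E) = Σ_slices lowerConst (decPoly N slice)` over `SOSDual.slicesFrom E ns` for ANY cut list `ns`
(`lowerConst_decPoly_slices`), and `lowerConst_decPoly_of_sliceVals` assembles per-slice kernel facts `lowerConst (decPoly N ((slicesFrom E ns).getD i
[])) = vᵢ` (each its own `decide +kernel`, e.g. 1 500 entries) into `lowerConst (decPoly N E) = vs.sum`. Nothing of record; no certificate evaluated;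
CONTROL/CALIBRATION context (wording (xx1)); no summit statement is proved by this file. Seat hubbard-obs-p2 (STIFFNESS), `prover-hubbard-obs-p2-g24-0`,
zero compute.

References: C. Jansson, D. Chaykin, C. Keil, SIAM J. Numer. Anal. 46 (2008) 180 (the rigorous lower bound `const − ℓ¹`) [JanssonChaykinKeil2008].
-/

namespace Summit.Ventures.CertifiedManyBodySolver

namespace CARPolyWindow

open Summit.Ventures.CertifiedQuantumChemistry Summit.Ventures.CertifiedQuantumChemistry.CARPoly

section Chunks

variable {α : Type*}

/-- `constCoeff` is additive over concatenation. [folklore] -/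
theorem constCoeff_append (A B : CARPoly.Poly α) : constCoeff (A ++ B) = constCoeff A + constCoeff B := by
  unfold constCoeff
  rw [List.foldl_append, foldl_add_eq]

/-- `l1Nonconst` is additive over concatenation. [folklore] -/
theorem l1Nonconst_append (A B : CARPoly.Poly α) : l1Nonconst (A ++ B) = l1Nonconst A + l1Nonconst B := by
  unfold l1Nonconst
  rw [List.foldl_append, foldl_add_eq]

/-- **`lowerConst` is additive over concatenation.** [cite: JanssonChaykinKeil2008, §3] -/
theorem lowerConst_append (A B : CARPoly.Poly α) : lowerConst (A ++ B) = lowerConst A + lowerConst B := by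
  rw [lowerConst, lowerConst, lowerConst, constCoeff_append, l1Nonconst_append]
  ring

/-- `lowerConst` of the empty polynomial. [folklore] -/
theorem lowerConst_nil : lowerConst ([] : CARPoly.Poly α) = 0 := by
  simp [lowerConst, constCoeff, l1Nonconst]

/-- `decPoly` is a `map`, hence additive over concatenation. [folklore] -/
theorem decPoly_append (k : ℕ) [NeZero k] (E F : SOSDual.EncPoly) : SOSDual.decPoly k (E ++ F) = SOSDual.decPoly k E ++ SOSDual.decPoly k F :=
  List.map_append

/-- `lowerConst ∘ decPoly` over a concatenation of encoded chunks is the sum over the chunks. [folklore] -/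
theorem lowerConst_decPoly_flatten (k : ℕ) [NeZero k] : ∀ Es : List SOSDual.EncPoly,
    lowerConst (SOSDual.decPoly k Es.flatten) = (Es.map fun E => lowerConst (SOSDual.decPoly k E)).sum
  | [] => by simp [SOSDual.decPoly, lowerConst_nil]
  | E :: Es => by
    rw [List.flatten_cons, decPoly_append, lowerConst_append, lowerConst_decPoly_flatten k Es, List.map_cons, List.sum_cons]

/-- **The chunked inequality datum: `lowerConst (decPoly N E)` is the sum over ANY consecutive slicing `slicesFrom E ns`.**
[cite: JanssonChaykinKeil2008, §3] -/
theorem lowerConst_decPoly_slices (k : ℕ) [NeZero k] (E : SOSDual.EncPoly) (ns : List ℕ) :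
    lowerConst (SOSDual.decPoly k E) = ((SOSDual.slicesFrom E ns).map fun S => lowerConst (SOSDual.decPoly k S)).sum := by
  conv_lhs => rw [← SOSDual.flatten_slicesFrom E ns]
  exact lowerConst_decPoly_flatten k _

/-- `slicesFrom` yields one more slice than cut points. [folklore] -/
theorem length_slicesFrom {β : Type*} : ∀ (L : List β) (ns : List ℕ), (SOSDual.slicesFrom L ns).length = ns.length + 1
  | L, [] => by simp [SOSDual.slicesFrom]
  | L, n :: ns => by rw [SOSDual.slicesFrom, List.length_cons, length_slicesFrom (L.drop n) ns, List.length_cons]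

/-- A map equals a list of values given position-wise. [folklore] -/
theorem map_eq_of_getD {β γ : Type*} (f : β → γ) (d : β) : ∀ (L : List β) (vs : List γ), vs.length = L.length →
    (∀ i (hi : i < vs.length), f (L.getD i d) = vs[i]) → L.map f = vs
  | [], [], _, _ => rfl
  | [], _ :: _, h, _ => by simp at h
  | _ :: _, [], h, _ => by simp at h
  | x :: L, v :: vs, hl, h => by
    have h0 := h 0 (by simp)
    simp only [List.getD_cons_zero, List.getElem_cons_zero] at h0
    rw [List.map_cons, h0, map_eq_of_getD f d L vs (by simpa using hl) fun i hi => by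
      have h' := h (i + 1) (by simpa using hi)
      simp only [List.getD_cons_succ, List.getElem_cons_succ] at h'
      exact h']

/-- **ASSEMBLY: per-slice kernel facts ⇒ the value of `lowerConst (decPoly N E)`.** An instance cuts its final accumulator with `ns`
(e.g. `[1500, 1500, 1500, 1500]`), proves `lowerConst (decPoly N ((slicesFrom E ns).getD i [])) = vs[i]` for each `i` by `decide +kernel`
(assembled by `interval_cases i` or a `Fin`-free `match`), and concludes. [cite: JanssonChaykinKeil2008, §3] -/
theorem lowerConst_decPoly_of_sliceVals (k : ℕ) [NeZero k] (E : SOSDual.EncPoly) (ns : List ℕ) (vs : List ℚ)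
    (hlen : vs.length = ns.length + 1)
    (h : ∀ i (hi : i < vs.length), lowerConst (SOSDual.decPoly k ((SOSDual.slicesFrom E ns).getD i [])) = vs[i]) :
    lowerConst (SOSDual.decPoly k E) = vs.sum := by
  rw [lowerConst_decPoly_slices k E ns, map_eq_of_getD (fun S => lowerConst (SOSDual.decPoly k S)) [] (SOSDual.slicesFrom E ns) vs
    (by rw [hlen, length_slicesFrom]) h]

end Chunks

end CARPolyWindow

end Summit.Ventures.CertifiedManyBodySolver
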